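import Summits.BirchSwinnertonDyer.BirchSwinnertonDyer.Theorems.Rank2ObservatoryRank3PSatCertCLT
import HarnessLib

/-!
# BirchSwinnertonDyer — rank ≥ 2 observatory: HASSE-FREE order certificates for `#Ẽ(𝔽_ℓ)`

HONEST FRAMING: per-curve certified theorems and census instruments; no claim on BSD in rank ≥ 2.

KS4 (cert-2; designed g37, landed g38): a drop-in killer Boolean `orderCertB` certifying the group order
`#Ẽ(𝔽_ℓ) = N` from an ORDER CERTIFICATE instead of a point count, for the kernel instruments whose
cost is dominated by the `O(ℓ)` Euler-criterion count (`killerLTB`) at primes `ℓ` in the thousands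
(KS4: index of the listed span free of every prime `≤ m_max`).

* `zmodPointCount_le` — the ELEMENTARY bound `#Ẽ(𝔽_ℓ) ≤ 2ℓ + 1` (each abscissa carries at most two
  ordinates: a quadratic over a field has at most two roots); no Hasse bound is used anywhere;
* `zmodPointCount_eq_of_orderCert` — if a point `G` of `Ẽ(𝔽_ℓ)` has exact order `m` (Pratt-style:
  `m • G = O` and `(m / r) • G ≠ O` for every prime `r ∣ m`) and `2ℓ + 1 < 2m`, then
  `#Ẽ(𝔽_ℓ) = m` (Lagrange `m ∣ #Ẽ` and `#Ẽ ≤ 2ℓ + 1 < 2m`);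
* `mulOps n` / `trace1C` / `multPointC V ℓ g n` — the COMPUTED double-and-add trace of `n • g`
  (unverified arithmetic with `invMod`), re-validated step by step by the landed `chainB` of
  `Rank2ObservatoryZModChain.lean`; soundness `exists_nsmul_eq_of_multPointC`;
* `orderCertB V (ℓ, N, X, Y, fs)` — the certificate Boolean: `ℓ` a good prime (`goodPrimeTB`),
  `2ℓ + 1 < 2N`, `G = (X, Y)` on `V mod ℓ`, `(N − 1) • G = −G` (so `N • G = O`), and for every
  listed prime power `(r, e)` of the COMPLETE factorisation `N = ∏ r ^ e` (`primeTDB r`) the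
  multiple `(N / r) • G` is an affine point; `killerB_of_orderCertB` — hence `killerB V (ℓ, N)`, so
  every soundness theorem stated over `killerB` applies verbatim (as `killerB_of_killerLB`).

Scope: the certificate exists iff `Ẽ(𝔽_ℓ)` is cyclic of order `N > ℓ + 1/2` (i.e. `a_ℓ < 0` up to
the boundary) and the binary chains for `N − 1` and the `N / r` avoid `O` and `±G` at chord steps;
the producer falls back to `killerLTB` otherwise. Kernel cost per killer: `O(log N · (1 + ω(N)))`
curve operations and `primeTDB` on the factors, instead of `ℓ` modular exponentiations.
Sorry-free; no `decide` is executed here (the Booleans are for data files).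

References: J. H. Silverman, *The Arithmetic of Elliptic Curves* (2nd ed. 2009), III.2.3, V.1;
V. Pratt, SIAM J. Comput. 4 (1975) 214–220 (succinct certificates via the order of an element);
J. E. Cremona, *Algorithms for Modular Elliptic Curves* (2nd ed. 1997), §2.4, §3.5.
-/

-- single-conjunct summit: `Summit.BirchSwinnertonDyer.BirchSwinnertonDyer.…` repeats the name
set_option linter.dupNamespace false

namespace Summit.BirchSwinnertonDyer.BirchSwinnertonDyer.Rank2Observatory

open WeierstrassCurve Finset Polynomial

/-! ### The elementary bound `#Ẽ(𝔽_ℓ) ≤ 2ℓ + 1` -/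

section Bound

variable {q : ℕ} [Fact q.Prime]

/-- Over the field `ZMod q`, a fibre `{y : y² + b·y = c}` has at most two elements (a monic
quadratic has at most two roots). [folklore] -/
theorem card_filter_fibre_le_two (b c : ZMod q) :
    #(univ.filter fun y : ZMod q => y ^ 2 + b * y = c) ≤ 2 := by
  classical
  set f : (ZMod q)[X] := C (1 : ZMod q) * X ^ 2 + C b * X + C (-c) with hf
  have hdeg : f.natDegree = 2 := natDegree_quadratic one_ne_zero
  have hf0 : f ≠ 0 := by
    intro h; rw [h, natDegree_zero] at hdeg; exact absurd hdeg (by norm_num)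
  have hsub : (univ.filter fun y : ZMod q => y ^ 2 + b * y = c) ⊆ f.roots.toFinset := by
    intro y hy
    rw [mem_filter] at hy
    rw [Multiset.mem_toFinset, mem_roots hf0, IsRoot.def, hf]
    simp only [eval_add, eval_mul, eval_C, eval_X, eval_pow]
    linear_combination hy.2
  calc #(univ.filter fun y : ZMod q => y ^ 2 + b * y = c)
      ≤ #f.roots.toFinset := card_le_card hsub
    _ ≤ Multiset.card f.roots := Multiset.toFinset_card_le _
    _ ≤ f.natDegree := card_roots' f
    _ = 2 := hdeg

/-- **`#Ẽ(𝔽_q) ≤ 2q + 1` (elementary, no Hasse):** the naive count `zmodPointCount V q` is at most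
`2q + 1`. [folklore] -/
theorem zmodPointCount_le (V : WeierstrassCurve ℤ) : zmodPointCount V q ≤ 2 * q + 1 := by
  classical
  have hpairs : #(univ.filter fun xy : ZMod q × ZMod q =>
      xy.2 ^ 2 + (V.a₁ : ZMod q) * xy.1 * xy.2 + (V.a₃ : ZMod q) * xy.2 =
        xy.1 ^ 3 + (V.a₂ : ZMod q) * xy.1 ^ 2 + (V.a₄ : ZMod q) * xy.1 + (V.a₆ : ZMod q)) =
      ∑ x : ZMod q, #(univ.filter fun y : ZMod q =>
        y ^ 2 + (V.a₁ : ZMod q) * x * y + (V.a₃ : ZMod q) * y =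
          x ^ 3 + (V.a₂ : ZMod q) * x ^ 2 + (V.a₄ : ZMod q) * x + (V.a₆ : ZMod q)) := by
    rw [card_filter, Fintype.sum_prod_type]
    refine sum_congr rfl fun x _ => ?_
    rw [card_filter]
  have hfib : ∀ x : ZMod q, #(univ.filter fun y : ZMod q =>
      y ^ 2 + (V.a₁ : ZMod q) * x * y + (V.a₃ : ZMod q) * y =
        x ^ 3 + (V.a₂ : ZMod q) * x ^ 2 + (V.a₄ : ZMod q) * x + (V.a₆ : ZMod q)) ≤ 2 := by
    intro x
    have h := card_filter_fibre_le_two ((V.a₁ : ZMod q) * x + (V.a₃ : ZMod q))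
      (x ^ 3 + (V.a₂ : ZMod q) * x ^ 2 + (V.a₄ : ZMod q) * x + (V.a₆ : ZMod q))
    refine le_trans (le_of_eq ?_) h
    congr 1; ext y; simp only [mem_filter, mem_univ, true_and]
    constructor <;> intro e <;> linear_combination e
  unfold zmodPointCount
  rw [hpairs]
  have hs : ∑ x : ZMod q, #(univ.filter fun y : ZMod q =>
      y ^ 2 + (V.a₁ : ZMod q) * x * y + (V.a₃ : ZMod q) * y =
        x ^ 3 + (V.a₂ : ZMod q) * x ^ 2 + (V.a₄ : ZMod q) * x + (V.a₆ : ZMod q)) ≤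
      ∑ _x : ZMod q, 2 := sum_le_sum fun x _ => hfib x
  rw [sum_const, card_univ, ZMod.card, smul_eq_mul] at hs
  omega

end Bound

/-! ### Exact order of one point ⇒ the group order -/

section OrderCert

variable (V : WeierstrassCurve ℤ) (q : ℕ) [Fact q.Prime]

/-- **Hasse-free order certificate ⇒ the exact group order.** If `q ∤ Δ`, a point `G` of
`Ẽ(𝔽_q)` satisfies `m • G = 0` and `(m / r) • G ≠ 0` for every prime `r ∣ m`, and `2q + 1 < 2m`,
then `#Ẽ(𝔽_q) = m` — hence `zmodPointCount V q = m` WITHOUT counting (Lagrange and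
`zmodPointCount_le`). [cite: SilvermanAEC2009, V.1] -/
theorem zmodPointCount_eq_of_orderCert (hq : ¬ (q : ℤ) ∣ V.Δ)
    (G : (V.map (Int.castRingHom (ZMod q))).toAffine.Point) {m : ℕ} (hm : 0 < m)
    (hG : m • G = 0) (hdiv : ∀ r : ℕ, r.Prime → r ∣ m → (m / r) • G ≠ 0)
    (hlt : 2 * q + 1 < 2 * m) : zmodPointCount V q = m := by
  classical
  have hord : addOrderOf G = m := addOrderOf_eq_of_nsmul_and_div_prime_nsmul hm hG hdiv
  have hcard := natCard_point_eq_zmodPointCount V q hq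
  have hdvd : m ∣ zmodPointCount V q := by
    rw [← hcard, ← hord]; exact addOrderOf_dvd_natCard G
  have hle : zmodPointCount V q ≤ 2 * q + 1 := zmodPointCount_le V
  obtain ⟨j, hj⟩ := hdvd
  have hpos : 0 < zmodPointCount V q := by unfold zmodPointCount; omega
  have hj1 : j = 1 := by
    rcases j with _ | _ | j
    · omega
    · rfl
    · nlinarith
  rw [hj, hj1, mul_one]

end OrderCert

/-! ### Computed single-point chains (unverified; re-validated by `chainB`) -/

section Mult

variable (V : WeierstrassCurve ℤ) (q : ℕ)

/-- Left-to-right double-and-add operations reaching the multiplier `n ≥ 1` from `1`, with fuel: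
`true` = double, `false` = add the base point. [folklore] -/
def mulOpsAux : ℕ → ℕ → List Bool
  | 0, _ => []
  | fuel + 1, n =>
    if n ≤ 1 then [] else mulOpsAux fuel (n / 2) ++ (true :: if n % 2 = 1 then [false] else [])

/-- Double-and-add operations for `n < 2^64`. [folklore] -/
def mulOps (n : ℕ) : List Bool := mulOpsAux 64 n

/-- The computed TRACE of an operation list from `cur` for the base point `g`: the operations with
their computed result points, in the format of `chainB`; `none` on a vertical tangent or chord.
[cite: SilvermanAEC2009, III.2.3] -/
def trace1C [NeZero q] (g : ZMod q × ZMod q) :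
    ZMod q × ZMod q → List Bool → Option (List (Bool × ZMod q × ZMod q))
  | _, [] => some []
  | cur, b :: rest =>
    match (if b then zmodDblC V q cur.1 cur.2 else zmodAddC V q cur.1 cur.2 g.1 g.2) with
    | none => none
    | some P =>
      match trace1C g P rest with
      | none => none
      | some tr => some ((b, P) :: tr)

/-- **The certified multiple** `n • g` as an affine point: the computed trace of `mulOps n` from
`g` passes `chainB` and reaches the multiplier `n`; `none` otherwise.
[cite: SilvermanAEC2009, III.2.3] -/
def multPointC [NeZero q] (g : ZMod q × ZMod q) (n : ℕ) : Option (ZMod q × ZMod q) :=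
  match trace1C V q g g (mulOps n) with
  | none => none
  | some tr =>
    if chainB V q g.1 g.2 g tr = true ∧ chainMult 1 tr = n then some (chainLast g tr) else none

variable [Fact q.Prime]

/-- Soundness of `multPointC`: the returned pair is a nonsingular point and equals `n • g`
(`exists_nsmul_eq_some_of_chainB`). [cite: SilvermanAEC2009, III.2.3] -/
theorem exists_nsmul_eq_of_multPointC {g : ZMod q × ZMod q}
    (hg : (V.map (Int.castRingHom (ZMod q))).toAffine.Nonsingular g.1 g.2) {n : ℕ}
    {P : ZMod q × ZMod q} (h : multPointC V q g n = some P) :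
    ∃ hP : (V.map (Int.castRingHom (ZMod q))).toAffine.Nonsingular P.1 P.2,
      n • (Affine.Point.some g.1 g.2 hg : (V.map (Int.castRingHom (ZMod q))).toAffine.Point) =
        .some P.1 P.2 hP := by
  unfold multPointC at h
  cases htr : trace1C V q g g (mulOps n) with
  | none => simp [htr] at h
  | some tr =>
    simp only [htr] at h
    by_cases hc : chainB V q g.1 g.2 g tr = true ∧ chainMult 1 tr = n
    · rw [if_pos hc, Option.some.injEq] at h
      obtain ⟨hP, e⟩ := exists_nsmul_eq_some_of_chainB V q hg tr g 1 hg (one_nsmul _) hc.1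
      subst h
      rw [hc.2] at e
      exact ⟨hP, e⟩
    · rw [if_neg hc] at h
      exact absurd h (by simp)

end Mult

/-! ### The order-certificate killer -/

section Killer

/-- ORDER CERTIFICATE for the killer `(ℓ, N)` (a Boolean for `decide`): `ℓ` a good prime
(`goodPrimeTB`), `2ℓ + 1 < 2N`, `G = (X, Y)` on `V mod ℓ`, `(N − 1) • G = −G`, and for the listed
complete factorisation `N = ∏ r ^ e` into primes (`primeTDB r`) each `(N / r) • G` is affine.
[cite: SilvermanAEC2009, V.1] -/
def orderCertB (V : WeierstrassCurve ℤ) : ℕ × ℕ × ℤ × ℤ × List (ℕ × ℕ) → Bool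
  | (0, _) => false
  | (ℓ + 1, N, X, Y, fs) =>
    goodPrimeTB V (ℓ + 1) &&
    decide (2 * (ℓ + 1) + 1 < 2 * N) &&
    decide ((Y : ZMod (ℓ + 1)) ^ 2 + (V.a₁ : ZMod (ℓ + 1)) * X * Y + (V.a₃ : ZMod (ℓ + 1)) * Y =
      (X : ZMod (ℓ + 1)) ^ 3 + (V.a₂ : ZMod (ℓ + 1)) * X ^ 2 + (V.a₄ : ZMod (ℓ + 1)) * X
        + (V.a₆ : ZMod (ℓ + 1))) &&
    decide (multPointC V (ℓ + 1) ((X : ZMod (ℓ + 1)), (Y : ZMod (ℓ + 1))) (N - 1) =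
      some ((X : ZMod (ℓ + 1)),
        -(Y : ZMod (ℓ + 1)) - (V.a₁ : ZMod (ℓ + 1)) * X - (V.a₃ : ZMod (ℓ + 1)))) &&
    fs.all (fun re => primeTDB re.1 &&
      (multPointC V (ℓ + 1) ((X : ZMod (ℓ + 1)), (Y : ZMod (ℓ + 1))) (N / re.1)).isSome) &&
    decide (N = (fs.map fun re => re.1 ^ re.2).prod)

/-- **`orderCertB ⇒ killerB`**: a checked order certificate gives the landed killer Boolean (same
prime, same count), so every soundness theorem stated over `killerB` applies verbatim.
[cite: SilvermanAEC2009, V.1] -/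
theorem killerB_of_orderCertB (V : WeierstrassCurve ℤ) {c : ℕ × ℕ × ℤ × ℤ × List (ℕ × ℕ)}
    (h : orderCertB V c = true) : killerB V (c.1, c.2.1) = true := by
  obtain ⟨ℓ, N, X, Y, fs⟩ := c
  cases ℓ with
  | zero => simp [orderCertB] at h
  | succ ℓ =>
    simp only [orderCertB, Bool.and_eq_true, decide_eq_true_eq, List.all_eq_true,
      Option.isSome_iff_exists] at h
    obtain ⟨⟨⟨⟨⟨hgood, hlt⟩, he⟩, hneg⟩, hfs⟩, hN⟩ := h
    have hgood' := goodPrimeB_of_goodPrimeTB V hgood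
    have hg2 := hgood'
    rw [goodPrimeB, Bool.and_eq_true, decide_eq_true_eq, decide_eq_true_eq] at hg2
    obtain ⟨hprime, hΔ⟩ := hg2
    haveI : Fact (ℓ + 1).Prime := ⟨hprime⟩
    -- the base point
    set W := V.map (Int.castRingHom (ZMod (ℓ + 1))) with hW
    have hE : W.toAffine.Equation (X : ZMod (ℓ + 1)) (Y : ZMod (ℓ + 1)) := by
      rw [Affine.equation_iff]
      simpa [hW, WeierstrassCurve.map] using he
    have hns : W.toAffine.Nonsingular (X : ZMod (ℓ + 1)) (Y : ZMod (ℓ + 1)) :=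
      (Affine.equation_iff_nonsingular_of_Δ_ne_zero (Δ_zmod_ne_zero V (ℓ + 1) hΔ)).mp hE
    set G : W.toAffine.Point := .some _ _ hns with hGdef
    -- `N • G = 0`
    have hNpos : 0 < N := by omega
    obtain ⟨hP, eP⟩ := exists_nsmul_eq_of_multPointC V (ℓ + 1)
      (g := ((X : ZMod (ℓ + 1)), (Y : ZMod (ℓ + 1)))) hns hneg
    have hnegG : -G = .some (X : ZMod (ℓ + 1))
        (-(Y : ZMod (ℓ + 1)) - (V.a₁ : ZMod (ℓ + 1)) * X - (V.a₃ : ZMod (ℓ + 1))) hP := by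
      rw [hGdef, Affine.Point.neg_some]
      congr 1
    have hN1 : (N - 1) • G = -G := by rw [hnegG]; exact eP
    have hNG : N • G = 0 := by
      have : N = (N - 1) + 1 := by omega
      rw [this, succ_nsmul, hN1, neg_add_cancel]
    -- `(N / r) • G ≠ 0` for every prime `r ∣ N`
    have hdiv : ∀ r : ℕ, r.Prime → r ∣ N → (N / r) • G ≠ 0 := by
      intro r hr hrN
      rw [hN] at hrN
      obtain ⟨a, ha, hra⟩ := (Prime.dvd_prod_iff hr.prime).mp hrN
      obtain ⟨re, hre, rfl⟩ := List.mem_map.mp ha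
      obtain ⟨hpr, P', hP'⟩ := hfs re hre
      have hr' : r = re.1 :=
        (Nat.prime_dvd_prime_iff_eq hr (prime_of_primeTDB hpr)).mp (hr.dvd_of_dvd_pow hra)
      obtain ⟨hP'', e''⟩ := exists_nsmul_eq_of_multPointC V (ℓ + 1)
        (g := ((X : ZMod (ℓ + 1)), (Y : ZMod (ℓ + 1)))) hns hP'
      rw [hr', ← hGdef] at *
      rw [e'']
      exact Affine.Point.some_ne_zero hP''
    have hcount : zmodPointCount V (ℓ + 1) = N :=
      zmodPointCount_eq_of_orderCert V (ℓ + 1) hΔ G hNpos hNG hdiv hlt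
    rw [killerB, Bool.and_eq_true]
    exact ⟨hgood', by rw [hcount]; exact beq_self_eq_true N⟩

/-- List form: `S.all (orderCertB V) ⇒ (S.map ⋯).all (killerB V)`. [folklore] -/
theorem all_killerB_of_all_orderCertB (V : WeierstrassCurve ℤ)
    {S : List (ℕ × ℕ × ℤ × ℤ × List (ℕ × ℕ))} (h : S.all (orderCertB V) = true) :
    (S.map fun c => (c.1, c.2.1)).all (killerB V) = true := by
  rw [List.all_map]
  exact List.all_eq_true.mpr fun c hc =>
    killerB_of_orderCertB V (List.all_eq_true.mp h c hc)

end Killer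

end Summit.BirchSwinnertonDyer.BirchSwinnertonDyer.Rank2Observatory
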